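import Literature.MathematicalPhysics.QuantumFieldTheory.YangMillsOS
import Literature.MathematicalPhysics.QuantumFieldTheory.ActionDensityTimeReflection
import Literature.MathematicalPhysics.QuantumFieldTheory.U1WardIdentity
import Literature.MathematicalPhysics.QuantumLattice.AbelianFieldTensor
import Literature.MathematicalPhysics.QuantumLattice.LatticeGaugeDLRFreeEnergyProofs
import HarnessLib

/-!
# `SelfNormalisedSkewness` — negative side: the `U(1)` curvature species in plaquette angles

Route `ScalingWindowSplit`, crux `stmt-QuantumFields-18944`, line `Sketch` (negation branch), support for the
lead's `stub_witnessAssembly`.  For `G = Circle` with the defining representation `u1Rep`: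

* `re_coe_circle_exp` — `Re e^{it} = cos t`;
* `plaquetteObs_u1Rep_torusLift_eq_cos` — the plaquette observable read on the periodic lift at `x ∈ ℤ⁴` is
  `cos F_{ij}(x mod S)` (Lüscher's abelian field tensor `abelianFieldTensor`);
* `actionDensity_u1_site_eq_sum_cos` — the site observable of the crux, `tr F²` of `u1Rep` read at `x` on the
  periodic lift, is `Σ_{i<j} cos F_{ij}(x mod S)`;
* `wilsonAction_u1_eq_sum_one_sub_cos` — Wilson's action is `Σ_p (1 − cos F_p)`.

References: Wilson 1974; Lüscher, Nucl. Phys. B 549 (1999) §3.  No definitions, no named facts.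
-/

noncomputable section

open scoped BigOperators
open MeasureTheory
open Literature.MathematicalPhysics.QuantumLattice Literature.MathematicalPhysics.AQFT
  Literature.MathematicalPhysics.QuantumFieldTheory
open Literature.Probability.LatticeModels (Torus.proj)

namespace Summit.QuantumFields.YangMills.Theorems.SelfNormalisedSkewness.Negative

/-- `Re e^{it} = cos t` for the exponential map of the unit circle. [folklore] -/
theorem re_coe_circle_exp (t : ℝ) : ((Circle.exp t : Circle) : ℂ).re = Real.cos t := by
  rw [Circle.coe_exp]
  exact Complex.exp_ofReal_mul_I_re t

/-- Plaquette holonomies of a translated `ℤ⁴` configuration: `(τ_v U)_{p at x} = U_{p at x − v}`. [folklore] -/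
theorem plaquetteHolonomyZd_configShift' {d : ℕ} {G : Type*} [Group G] [MeasurableSpace G]
    (v : Literature.Probability.LatticeModels.Site d) (U : LGConfig d G)
    (x : Literature.Probability.LatticeModels.Site d) (i j : Fin d) :
    plaquetteHolonomyZd (configShift v U) x i j = plaquetteHolonomyZd U (x - v) i j := by
  simp only [plaquetteHolonomyZd, configShift_apply, add_sub_right_comm]

/-- **The `U(1)` plaquette observable on the periodic lift is the cosine of the plaquette angle**:
`Re tr u1Rep(Ũ_{p(x,i,j)}) = cos F_{ij}(x mod S)`. [folklore] -/
theorem plaquetteObs_u1Rep_torusLift_eq_cos {S : ℕ} (U : GaugeConfig 4 S Circle)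
    (x : Literature.Probability.LatticeModels.Site 4) (i j : Fin 4) :
    plaquetteObs u1Rep x i j (torusLift S U) = Real.cos (abelianFieldTensor U (Torus.proj S x) i j) := by
  have h : plaquetteObs u1Rep x i j (torusLift S U) = ((plaquetteHolonomyZd (torusLift S U) x i j : Circle) : ℂ).re := by
    simp [plaquetteObs, u1Rep_apply, Matrix.scalar_apply, Matrix.trace]
  rw [h, FreeEnergy.plaquetteHolonomyZd_torusLift, ← exp_abelianFieldTensor, re_coe_circle_exp]

/-- **The crux's site observable for `U(1)`**: the curvature species of `u1Rep` (the corner action density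
`Σ_{i<j} Re tr U_{p(0,i,j)}`, which is `(⟨1, u1Rep, …⟩ : LatticeRep Circle).curvature.F` by `rfl`) read at site `x`
of the periodic lift is `Σ_{i<j} cos F_{ij}(x mod S)`. [folklore] -/
theorem actionDensity_u1_site_eq_sum_cos {S : ℕ} (U : GaugeConfig 4 S Circle)
    (x : Literature.Probability.LatticeModels.Site 4) :
    actionDensity u1Rep (configShift (-x) (torusLift S U)) =
      ∑ q : {q : Fin 4 × Fin 4 // q.1 < q.2}, Real.cos (abelianFieldTensor U (Torus.proj S x) q.1.1 q.1.2) := by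
  rw [actionDensity_eq_sum_subtype]
  refine Finset.sum_congr rfl fun q _ => ?_
  rw [plaquetteObs, plaquetteHolonomyZd_configShift', sub_neg_eq_add, zero_add, ← plaquetteObs,
    plaquetteObs_u1Rep_torusLift_eq_cos]

/-- **Wilson's `U(1)` action in plaquette angles**: `S(U) = Σ_p (1 − cos F_p)`. [folklore] -/
theorem wilsonAction_u1_eq_sum_one_sub_cos {S : ℕ} [NeZero S] (U : GaugeConfig 4 S Circle) :
    wilsonAction u1Rep U =
      ∑ p : Plaquette 4 S, (1 - Real.cos (abelianFieldTensor U p.1 p.2.1.1 p.2.1.2)) := by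
  rw [wilsonAction_u1_eq]
  refine Finset.sum_congr rfl fun p _ => ?_
  rw [← exp_abelianFieldTensor, re_coe_circle_exp]

end Summit.QuantumFields.YangMills.Theorems.SelfNormalisedSkewness.Negative

end
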